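import Literature.NumberTheory.GaloisRepresentations.TeichmullerCharacter
import Literature.NumberTheory.QuadraticFields.DiscriminantCharacter
import Literature.NumberTheory.EllipticCurves.EisensteinNewformLevelRaisingDeligneSerreLiftProofs
import Literature.NumberTheory.LFunctions.RayClassCharacter
import Mathlib.NumberTheory.LegendreSymbol.JacobiSymbol
import HarnessLib

/-!
# Trivial Nebentypus of the twisted Größencharakter: `ψ̃((n)) = (d_k/n)·n` for odd `n`

Route `ResidualThetaTransportAtTwo`, crux K0⁺ `HeckeThetaPartnerAdicAtTwo` (stmt-BirchSwinnertonDyer-20690),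
helper §H of the line "proof from print" (the hypothesis `ψ((n)) = (d_K/n) n^{k-1}` of the named fact
`Ribet1977_cmNewform_gamma0_of_isGrossencharakter`, `k = 2`).  THEOREMS ONLY (no definition, no named
fact, no `sorry`).

* `symm_eq_one_of_congr_odd` — if `u` is a root of unity of odd order and `u · m ≡ 1` (`2`-adically along
  `e : ℚ̄₂ ≃ ℂ`) for an odd integer `m`, then `u = 1` (distinct roots of unity of odd order are
  incongruent modulo `𝔪_{ℤ̄₂}`, `eq_of_pow_eq_one_of_norm_sub_lt_one`);
* `idealPow_natCast_eq_jacobiSym_mul` — if `ψ̃₀((n)) = n · χ_{d}(n)` (the type-`(1,0)` character with unit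
  character `λ(n̄) = (d/n)`, helpers E1/E1′), `ψ̃((n)) = ψ̃₀((n)) · u` with `u` of odd order and
  `u · ψ̃₀((n)) ≡ χ̃((n)) = 1` (the Teichmüller twist E2 and `CubicFields.idealPow_span_intCast_eq_one`),
  then `ψ̃((n)) = (d/n) · n^{2-1}` for odd `n` prime to `d`.

Reference: K. Ribet, LNM 601 (1977) §3, p. 35 (`η(a) = ψ((a))/σ(a)^{k-1}`, `ε = ηφ`).
-/

set_option autoImplicit false
set_option linter.dupNamespace false

noncomputable section

open scoped NumberField
open NumberField IsDedekindDomain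
open Literature.NumberTheory.GaloisRepresentations Literature.NumberTheory.LFunctions
  Literature.NumberTheory.QuadraticFields Literature.NumberTheory.QuadraticFields.Quadratic
  Literature.NumberTheory.EllipticCurves.ModularForms

namespace Summit.BirchSwinnertonDyer.BirchSwinnertonDyer.Theorems.HeckeThetaPartner

/-- **A root of unity of odd order congruent to `1` is `1`**: if `u^N = 1` with `N` odd, `m` is an odd
integer and `‖e⁻¹u · m - 1‖ < 1`, then `u = 1`. [cite: SerreLocalFields1979, Ch. II §4, Prop. 8] -/
theorem symm_eq_one_of_congr_odd (e : PadicAlgCl 2 ≃+* ℂ) {u : ℂ} {N : ℕ} (hN : 0 < N) (hN2 : ¬ 2 ∣ N)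
    (hu : u ^ N = 1) {m : ℤ} (hm : Odd m) (h : ‖e.symm u * (m : PadicAlgCl 2) - 1‖ < 1) : u = 1 := by
  have hm1 : ‖(m : PadicAlgCl 2) - 1‖ < 1 := by
    have : ((m : PadicAlgCl 2) - 1) = ((m - 1 : ℤ) : PadicAlgCl 2) := by push_cast; ring
    rw [this, ← map_intCast (algebraMap ℚ_[2] (PadicAlgCl 2)), PadicAlgCl.norm_extends]
    obtain ⟨r, hr⟩ := hm
    rw [hr, show (2 * r + 1 - 1 : ℤ) = 2 * r by ring, Int.cast_mul, norm_mul]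
    have h2 : ‖((2 : ℤ) : ℚ_[2])‖ < 1 := by exact_mod_cast Padic.norm_p_lt_one (p := 2)
    exact (mul_le_of_le_one_right (norm_nonneg _) (Padic.norm_int_le_one r)).trans_lt h2
  have hmu : ‖(m : PadicAlgCl 2)‖ = 1 :=
    DeligneSerreLift.norm_intCast_eq_one_of_not_dvd (p := 2) (by
      intro h2; exact Int.not_even_iff_odd.mpr hm (even_iff_two_dvd.mpr (by exact_mod_cast h2)))
  -- `(e⁻¹u - 1) m = (e⁻¹u m - 1) - (m - 1)`
  have hkey : ‖(e.symm u - 1) * (m : PadicAlgCl 2)‖ < 1 := by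
    have : (e.symm u - 1) * (m : PadicAlgCl 2) = (e.symm u * m - 1) - ((m : PadicAlgCl 2) - 1) := by ring
    rw [this, sub_eq_add_neg]
    refine (IsUltrametricDist.norm_add_le_max _ _).trans_lt (max_lt h ?_)
    rwa [norm_neg]
  rw [norm_mul, hmu, mul_one] at hkey
  have h1 : e.symm u = 1 :=
    eq_of_pow_eq_one_of_norm_sub_lt_one (p := 2) hN hN2 (by rw [← map_pow, hu, map_one]) (one_pow N) hkey
  exact e.symm.injective (by rw [h1, map_one])

variable {k : Type} [Field k] [NumberField k]

/-- **`ψ̃((n)) = (d/n) · n` for odd `n` prime to `d`** from the three inputs of the line: the type-`(1,0)`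
values `ψ̃₀((n)) = n · χ_d([n])`, the Teichmüller twist `ψ̃((n)) = ψ̃₀((n)) · u` with `u` of odd order
and `u · ψ̃₀((n)) ≡ 1`, and Cox's `χ_d([n]) = (d/n)` (`discrChar_apply_eq_jacobiSym`).
[cite: Ribet1977Nebentypus, §3 (p. 35, `η = φ`)] -/
theorem idealPow_natCast_eq_jacobiSym_mul (e : PadicAlgCl 2 ≃+* ℂ) {ψ ψ₀ : HeightOneSpectrum (𝓞 k) → ℂ}
    {d : ℤ} (hd0 : d ≠ 0) (hd4 : d % 4 = 1) {n : ℕ} (hn : Odd n) (hnd : n.Coprime d.natAbs)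
    (hu : IsUnit (n : ZMod d.natAbs))
    (hψ₀ : idealPow k ψ₀ (Ideal.span {(n : 𝓞 k)}) = (n : ℂ) * ((discrChar d hu.unit : ℤˣ) : ℤ))
    (hψ : ∃ u : ℂ, (∃ N : ℕ, 0 < N ∧ ¬ 2 ∣ N ∧ u ^ N = 1) ∧
      idealPow k ψ (Ideal.span {(n : 𝓞 k)}) = idealPow k ψ₀ (Ideal.span {(n : 𝓞 k)}) * u ∧
      ‖e.symm u * e.symm (idealPow k ψ₀ (Ideal.span {(n : 𝓞 k)})) - e.symm 1‖ < 1) :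
    idealPow k ψ (Ideal.span {(n : 𝓞 k)}) = (jacobiSym d n : ℂ) * (n : ℂ) ^ (2 - 1) := by
  obtain ⟨u, ⟨N, hN, hN2, huN⟩, hψu, hcong⟩ := hψ
  have hJ : ((discrChar d hu.unit : ℤˣ) : ℤ) = jacobiSym d n :=
    discrChar_apply_eq_jacobiSym hd0 (Or.inr hd4) hn (by rw [IsUnit.unit_spec])
  rw [hJ] at hψ₀
  -- `m = n (d/n)` is an odd integer
  have hJ1 : jacobiSym d n = 1 ∨ jacobiSym d n = -1 :=
    jacobiSym.eq_one_or_neg_one (by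
      change d.natAbs.gcd (n : ℤ).natAbs = 1
      rw [Int.natAbs_natCast, Nat.gcd_comm]; exact hnd)
  have hm : Odd ((n : ℤ) * jacobiSym d n) := by
    have hn' : Odd (n : ℤ) := by exact_mod_cast hn
    rcases hJ1 with h | h <;> rw [h] <;> simp [hn']
  have hψ₀' : idealPow k ψ₀ (Ideal.span {(n : 𝓞 k)}) = (((n : ℤ) * jacobiSym d n : ℤ) : ℂ) := by
    rw [hψ₀]; push_cast; ring
  have hcong' : ‖e.symm u * ((((n : ℤ) * jacobiSym d n : ℤ)) : PadicAlgCl 2) - 1‖ < 1 := by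
    rw [hψ₀', map_intCast, map_one] at hcong; exact hcong
  have hu1 : u = 1 := symm_eq_one_of_congr_odd e hN hN2 huN hm hcong'
  rw [hψu, hu1, mul_one, hψ₀]
  ring

end Summit.BirchSwinnertonDyer.BirchSwinnertonDyer.Theorems.HeckeThetaPartner

end
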